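import Summits.Schanuel.Schanuel.Theorems.ZilberEacSuperellipticConstFibre
import HarnessLib

/-!
# Arbitrary base branches, LIII (a): a BÉZOUT IDENTITY for the rows of an irreducible curve —
# a polynomial of lower degree cannot vanish along a branch of the curve

HONEST FRAMING.  Cell `pub-schanuel` (Zilber's Exponential-Algebraic Closedness, case ladder;
host summit Schanuel), seat 2, gen 30.  Pure algebra for the general polynomial fibre over the
curves `x₁^k = P(x₀)` (`k ≥ 3`, file LIII (b)).  For `F ∈ ℂ[x₀][x₁]` monic and irreducible and
`R ≠ 0` of smaller `x₁`-degree, Gauss's lemma (`F` stays irreducible over `ℂ(x₀)`) and Bézout in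
`ℂ(x₀)[x₁]` give, after clearing denominators, **`exists_bezout_of_irreducible`**:
`U·F + V·R = D(x₀)` with `D ≠ 0`.  Consequently (**`not_eventually_rows_eq_zero_of_bezout`**) `R`
cannot vanish along any family of points of `F = 0` whose `x₀`-coordinate is unbounded — in
particular along a sheet at infinity of `x₁^k = P(x₀)` (**`not_eventually_zero_along_cyclicSheet`**).
No claim about EAC is made here.  EC(3,2) OPEN; NOT Schanuel's conjecture; EAC ⇏ SC.
-/

noncomputable section

open Filter Topology Polynomial

set_option linter.dupNamespace false

namespace Summit.Schanuel.Schanuel.Theorems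

/-! ## Part A. Bézout with a denominator -/

/-- **Bézout for the rows of an irreducible curve.**  `F ∈ ℂ[x₀][x₁]` monic irreducible, `R ≠ 0`
with `deg_{x₁} R < deg_{x₁} F`: there are `U, V ∈ ℂ[x₀][x₁]` and `D ∈ ℂ[x₀] ∖ {0}` with
`U·F + V·R = D` (Gauss's lemma over the integrally closed `ℂ[x₀]`, Bézout in `ℂ(x₀)[x₁]`, clearing
denominators). [folklore] -/
theorem exists_bezout_of_irreducible (F R : ℂ[X][X]) (hF : F.Monic) (hFirr : Irreducible F)
    (hR : R ≠ 0) (hdeg : R.natDegree < F.natDegree) :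
    ∃ (U V : ℂ[X][X]) (D : ℂ[X]), D ≠ 0 ∧ U * F + V * R = C D := by
  classical
  set i : ℂ[X] →+* FractionRing ℂ[X] := algebraMap ℂ[X] (FractionRing ℂ[X]) with hi_def
  have hi : Function.Injective i := IsFractionRing.injective ℂ[X] (FractionRing ℂ[X])
  have hF'irr : Irreducible (F.map i) :=
    (hF.irreducible_iff_irreducible_map_fraction_map (K := FractionRing ℂ[X])).1 hFirr
  haveI : IsPrincipalIdealRing (FractionRing ℂ[X])[X] :=
    EuclideanDomain.to_principal_ideal_domain (R := (FractionRing ℂ[X])[X])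
  have hR' : R.map i ≠ 0 := (Polynomial.map_ne_zero_iff hi).2 hR
  have hdeg' : (R.map i).natDegree < (F.map i).natDegree := by
    rwa [Polynomial.natDegree_map_eq_of_injective hi, Polynomial.natDegree_map_eq_of_injective hi]
  have hndvd : ¬ F.map i ∣ R.map i := fun h => by
    have := Polynomial.natDegree_le_of_dvd h hR'
    omega
  obtain ⟨u, v, huv⟩ := hF'irr.coprime_iff_not_dvd.2 hndvd
  obtain ⟨b₁, hb₁, hU⟩ := IsLocalization.integerNormalization_spec (nonZeroDivisors ℂ[X]) u
  obtain ⟨b₂, hb₂, hV⟩ := IsLocalization.integerNormalization_spec (nonZeroDivisors ℂ[X]) v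
  set U₀ : ℂ[X][X] := IsLocalization.integerNormalization (nonZeroDivisors ℂ[X]) u with hU₀
  set V₀ : ℂ[X][X] := IsLocalization.integerNormalization (nonZeroDivisors ℂ[X]) v with hV₀
  refine ⟨C b₂ * U₀, C b₁ * V₀, b₁ * b₂,
    mul_ne_zero (nonZeroDivisors.ne_zero hb₁) (nonZeroDivisors.ne_zero hb₂), ?_⟩
  apply Polynomial.map_injective i hi
  rw [Polynomial.map_add, Polynomial.map_mul, Polynomial.map_mul, Polynomial.map_mul,
    Polynomial.map_mul, Polynomial.map_C, Polynomial.map_C, hU, hV, Polynomial.map_C,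
    Algebra.smul_def, Algebra.smul_def, Polynomial.algebraMap_apply, Polynomial.algebraMap_apply,
    map_mul i, Polynomial.C_mul]
  linear_combination (C (i b₁) * C (i b₂)) * huv

/-! ## Part B. A lower-degree polynomial cannot vanish along an unbounded family of points -/

/-- A nonzero polynomial has no zeros of large norm. [folklore] -/
theorem eventually_eval_ne_zero_of_tendsto_norm {D : ℂ[X]} (hD : D ≠ 0) {α : Type*} {l : Filter α}
    {x : α → ℂ} (hx : Tendsto (fun a => ‖x a‖) l atTop) : ∀ᶠ a in l, D.eval (x a) ≠ 0 := by
  have hfin : Set.Finite {z : ℂ | D.IsRoot z} := Polynomial.finite_setOf_isRoot hD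
  obtain ⟨r, hr⟩ := (Metric.isBounded_iff_subset_closedBall (0 : ℂ)).1 hfin.isBounded
  filter_upwards [hx.eventually_gt_atTop r] with a ha hzero
  have hmem : x a ∈ Metric.closedBall (0 : ℂ) r := hr hzero
  rw [Metric.mem_closedBall, dist_zero_right] at hmem
  linarith

/-- **`R` does not vanish along an unbounded family of points of `F = 0`** when
`U·F + V·R = D(x₀)`, `D ≠ 0`. [folklore] -/
theorem not_eventually_rows_eq_zero_of_bezout {F R U V : ℂ[X][X]} {D : ℂ[X]} (hD : D ≠ 0)
    (hUV : U * F + V * R = C D) {α : Type*} {l : Filter α} [l.NeBot] {x₀ x₁ : α → ℂ}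
    (hx₀ : Tendsto (fun a => ‖x₀ a‖) l atTop)
    (hF : ∀ᶠ a in l, (F.map (Polynomial.evalRingHom (x₀ a))).eval (x₁ a) = 0) :
    ¬ ∀ᶠ a in l, (R.map (Polynomial.evalRingHom (x₀ a))).eval (x₁ a) = 0 := by
  intro hR
  obtain ⟨a, hFa, hRa, hDa⟩ :=
    (hF.and (hR.and (eventually_eval_ne_zero_of_tendsto_norm hD hx₀))).exists
  apply hDa
  have h := congrArg (fun G : ℂ[X][X] => (G.map (Polynomial.evalRingHom (x₀ a))).eval (x₁ a)) hUV
  simp only [Polynomial.map_add, Polynomial.map_mul, Polynomial.eval_add, Polynomial.eval_mul,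
    hFa, hRa, mul_zero, add_zero, Polynomial.map_C, Polynomial.eval_C,
    Polynomial.coe_evalRingHom] at h
  exact h.symm

/-! ## Part C. Along a sheet at infinity of `x₁^k = P(x₀)` -/

section CyclicSheet

variable (P : ℂ[X])

/-- **A polynomial of `x₁`-degree `< k` that vanishes along a sheet at infinity of
`x₁^k = P(x₀)` is zero** (`k ≥ 1`, `P` with a simple root; the sheet: `x₀ = s^{-k}`,
`x₁ = Φ(s)s^{-M}` for small `s ≠ 0`). [folklore] -/
theorem rows_eq_zero_of_eventually_zero_along_cyclicSheet {k : ℕ} (hk : 1 ≤ k) {r : ℂ}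
    (hr : P.IsRoot r) (hr1 : P.derivative.eval r ≠ 0) (R : ℂ[X][X]) (hdeg : R.natDegree < k)
    {Φ : ℂ → ℂ}
    (hsheet : ∀ᶠ s in 𝓝[≠] (0 : ℂ), (Φ s * (s ^ P.natDegree)⁻¹) ^ k - P.eval (s ^ k)⁻¹ = 0)
    (hR : ∀ᶠ s in 𝓝[≠] (0 : ℂ),
      (R.map (Polynomial.evalRingHom (s ^ k)⁻¹)).eval (Φ s * (s ^ P.natDegree)⁻¹) = 0) :
    R = 0 := by
  by_contra hR0
  set F : ℂ[X][X] := X ^ k - C P with hFdef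
  have hFm : F.Monic := Polynomial.monic_X_pow_sub_C _ (by omega)
  have hFdeg : F.natDegree = k := Polynomial.natDegree_X_pow_sub_C
  have hFirr : Irreducible F := by
    have h := irreducible_superelliptic_row P hk hr hr1
    rwa [map_neg, ← sub_eq_add_neg] at h
  obtain ⟨U, V, D, hD, hUV⟩ :=
    exists_bezout_of_irreducible F R hFm hFirr hR0 (by rw [hFdeg]; exact hdeg)
  have hx₀ : Tendsto (fun s : ℂ => ‖(s ^ k)⁻¹‖) (𝓝[≠] (0 : ℂ)) atTop := by
    have h1 : Tendsto (fun s : ℂ => s ^ k) (𝓝[≠] (0 : ℂ)) (𝓝[≠] 0) := by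
      refine tendsto_nhdsWithin_iff.2 ⟨?_, ?_⟩
      · have : Tendsto (fun s : ℂ => s ^ k) (𝓝 (0 : ℂ)) (𝓝 (0 ^ k)) :=
          (continuous_pow k).continuousAt.tendsto
        rw [zero_pow (by omega)] at this
        exact this.mono_left nhdsWithin_le_nhds
      · filter_upwards [self_mem_nhdsWithin] with s hs
        exact pow_ne_zero _ hs
    exact (tendsto_norm_inv_nhdsNE_zero_atTop (α := ℂ)).comp h1
  have hF : ∀ᶠ s in 𝓝[≠] (0 : ℂ),
      (F.map (Polynomial.evalRingHom (s ^ k)⁻¹)).eval (Φ s * (s ^ P.natDegree)⁻¹) = 0 := by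
    filter_upwards [hsheet] with s hs
    rw [hFdef]
    simp only [Polynomial.map_sub, Polynomial.map_pow, Polynomial.map_X, Polynomial.map_C,
      Polynomial.eval_sub, Polynomial.eval_pow, Polynomial.eval_X, Polynomial.eval_C,
      Polynomial.coe_evalRingHom]
    exact hs
  exact not_eventually_rows_eq_zero_of_bezout hD hUV hx₀ hF hR

end CyclicSheet

/-! ## Part D. The general form: any unbounded family of points -/

/-- **A polynomial of lower `x₁`-degree vanishing along an unbounded family of points of an
irreducible monic curve is zero** (`F` monic irreducible, `deg_{x₁} R < deg_{x₁} F`; the family: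
`F(x₀(a), x₁(a)) = 0` along a nontrivial filter with `‖x₀(a)‖ → ∞`). [folklore] -/
theorem rows_eq_zero_of_eventually_zero_of_irreducible (F R : ℂ[X][X]) (hF : F.Monic)
    (hFirr : Irreducible F) (hdeg : R.natDegree < F.natDegree) {α : Type*} {l : Filter α} [l.NeBot]
    {x₀ x₁ : α → ℂ} (hx₀ : Tendsto (fun a => ‖x₀ a‖) l atTop)
    (hFz : ∀ᶠ a in l, (F.map (Polynomial.evalRingHom (x₀ a))).eval (x₁ a) = 0)
    (hR : ∀ᶠ a in l, (R.map (Polynomial.evalRingHom (x₀ a))).eval (x₁ a) = 0) : R = 0 := by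
  by_contra hR0
  obtain ⟨U, V, D, hD, hUV⟩ := exists_bezout_of_irreducible F R hF hFirr hR0 hdeg
  exact not_eventually_rows_eq_zero_of_bezout hD hUV hx₀ hFz hR

end Summit.Schanuel.Schanuel.Theorems

end
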